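import Literature.NumberTheory.LFunctions.RiemannXi
import Literature.NumberTheory.LFunctions.JensenDegreeDescent
import Literature.Analysis.Complex.JensenPolynomialHyperbolicity
import Literature.Analysis.Complex.JensenLaguerreFlow
import Literature.Analysis.Complex.HutchinsonMultiplier
import Literature.Algebra.Polynomial.DescartesSignVariations
import HarnessLib

/-!
# COUNT MONOTONICITY OF THE JENSEN ARRAY (LINE L4 «Jensen edge law», part A) — cell `rh-split`, seat rh-split-jen-neg g14

HONEST LABEL: «SPLITTING SEARCH over kernel-typed RH-EQUIVALENCES; a splitting A ∧ B ⟹ RH is CONDITIONAL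
bookkeeping unless A and B are both proved; nothing here bears on the truth of RH.»  Everything in this file is
RH-FREE real-polynomial analysis (class level); no statement mentions ξ or RH.

Write `N(q) := nonrealRootCount q` (degree minus the number of real roots counted with multiplicity) and
`J^{d,n}_γ := jensenPoly γ d n`.  This file proves, for EVERY real sequence `γ`:

* T1 `nonrealRootCount_jensenPoly_succ_le` : `N(J^{d,n}) ≤ N(J^{d+1,n})` — non-real zeros, once born in a row, never die as
  the degree grows (ledger item `EarlyAppointments.JensenCountMonoDegree`, stmt-RiemannHypothesis-22161, closed in part C);
* T2 `nonrealRootCount_jensenPoly_shift_le` : `N(J^{d,n+1}) ≤ N(J^{d+1,n})` (Rolle: `(J^{d+1,n})' = (d+1)·J^{d,n+1}`);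
* births are thresholds: `not_splits_jensenPoly_of_le`, `splits_iff_lt_birth` (per row the hyperbolic degrees form an initial
  segment or all of `ℕ`) — the converse companion of the tree's `JensenDegreeDescent.splits_jensenPoly_of_le`.

MECHANISM.  The descent identity `(d+1)·J^{d,n} = (d+1)·J^{d+1,n} − X·(J^{d+1,n})'` (`Nat.choose_mul_succ_eq`) exhibits
descent as the Euler-type operator `q ↦ D·q − X·q'` on `deg q ≤ D`; coefficient reflection at `D` conjugates it into
`p ↦ X·p'` (`reflect_euler`), `N` is reflection-invariant (`nonrealRootCount_reflect`, via the tree's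
`Descartes.roots_reverse_of_ne_zero`), and Rolle gives `N(p') ≤ N(p)`.
Source: desk file HOME=run/shared/lean/pub/rh-split/rh-split-jen-neg/g14/line/LineCountMonotonicity.lean ddc26a9f2d8afa85.
-/

noncomputable section

set_option linter.dupNamespace false

namespace Summit.RiemannHypothesis.RiemannHypothesis.Theorems.Splittings.JensenCountMonotonicity

open Polynomial
open Literature.NumberTheory.LFunctions
open Literature.Analysis.Complex

/-- Scalars do not change the count. -/
theorem nonrealRootCount_C_mul {c : ℝ} (hc : c ≠ 0) (q : ℝ[X]) :
    nonrealRootCount (C c * q) = nonrealRootCount q := by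
  unfold nonrealRootCount
  rw [natDegree_C_mul hc, roots_C_mul _ hc]

/-- Rolle in count form: `N(q') ≤ N(q)` (from Mathlib's `card_roots_le_derivative`). -/
theorem nonrealRootCount_derivative_le (q : ℝ[X]) :
    nonrealRootCount (derivative q) ≤ nonrealRootCount q := by
  unfold nonrealRootCount
  have h1 := natDegree_derivative_le q
  have h2 := card_roots_le_derivative q
  have h3 := card_roots' (derivative q)
  omega


/-- **T2 (proved):** `N(J^{d,n+1}) ≤ N(J^{d+1,n})`, from `(J^{d+1,n})' = (d+1)·J^{d,n+1}` and Rolle. -/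
theorem nonrealRootCount_jensenPoly_shift_le (γ : ℕ → ℝ) (d n : ℕ) :
    nonrealRootCount (jensenPoly γ d (n + 1)) ≤ nonrealRootCount (jensenPoly γ (d + 1) n) := by
  have hne : ((d : ℝ) + 1) ≠ 0 := by positivity
  rw [← nonrealRootCount_C_mul hne, ← JensenLaguerreFlow.derivative_jensenPoly_succ]
  exact nonrealRootCount_derivative_le _

/-- Coefficients of a Jensen row without the range guard. -/
theorem coeff_jensenPoly' (γ : ℕ → ℝ) (d n j : ℕ) :
    (jensenPoly γ d n).coeff j = (d.choose j : ℝ) * γ (n + j) := by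
  rw [PolyaSchur.coeff_jensenPoly]
  split_ifs with h
  · rfl
  · rw [Nat.choose_eq_zero_of_lt (not_le.mp h)]; simp

/-- The descent identity `(d+1)·J^{d,n} = (d+1)·J^{d+1,n} − X·(J^{d+1,n})'`, from `Nat.choose_mul_succ_eq`. -/
theorem descent_identity (γ : ℕ → ℝ) (d n : ℕ) :
    C ((d : ℝ) + 1) * jensenPoly γ d n
      = C ((d : ℝ) + 1) * jensenPoly γ (d + 1) n - X * derivative (jensenPoly γ (d + 1) n) := by
  ext k
  simp only [coeff_C_mul, coeff_sub, coeff_jensenPoly']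
  rcases k with _ | k
  · simp
  · rw [coeff_X_mul, coeff_derivative, coeff_jensenPoly']
    rcases le_or_gt k d with hk | hk
    · have h := Nat.choose_mul_succ_eq d (k + 1)
      have h' : (d.choose (k + 1) : ℝ) * ((d : ℝ) + 1) = ((d + 1).choose (k + 1) : ℝ) * ((d : ℝ) - k) := by
        have : d + 1 - (k + 1) = d - k := by omega
        rw [this] at h
        have hc := congrArg (fun x : ℕ => (x : ℝ)) h
        push_cast [Nat.cast_sub hk] at hc
        exact hc
      linear_combination (γ (n + (k + 1))) * h'
    · have h1 : d.choose (k + 1) = 0 := Nat.choose_eq_zero_of_lt (by omega)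
      have h2 : (d + 1).choose (k + 1) = 0 := Nat.choose_eq_zero_of_lt (by omega)
      simp [h1, h2]


/-! ## Node N4 proved: reflection conjugates `D − X·d/dX` into `X·d/dX` -/

/-- `N(X^k f) = N(f)` for `f ≠ 0`. -/
theorem nonrealRootCount_X_pow_mul (k : ℕ) {f : ℝ[X]} (hf : f ≠ 0) :
    nonrealRootCount (X ^ k * f) = nonrealRootCount f := by
  unfold nonrealRootCount
  rw [natDegree_X_pow_mul k hf, roots_mul (mul_ne_zero (pow_ne_zero _ X_ne_zero) hf), roots_X_pow]
  simp only [Multiset.card_add, Multiset.card_nsmul, Multiset.card_singleton, mul_one]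
  have := card_roots' f
  omega

/-- NODE N1 in strong form (proved): `N(reverse f) = N(f)` for EVERY real polynomial (the reversed polynomial's
roots are the inverses of the nonzero roots, tree lemma `Descartes.roots_reverse_of_ne_zero`, and the degree drops by
exactly the multiplicity of `0`). -/
theorem nonrealRootCount_reverse (f : ℝ[X]) : nonrealRootCount f.reverse = nonrealRootCount f := by
  classical
  rcases eq_or_ne f 0 with rfl | hf
  · simp [nonrealRootCount]
  unfold nonrealRootCount
  have hdeg := natDegree_eq_reverse_natDegree_add_natTrailingDegree f
  have hmult : f.rootMultiplicity 0 = f.natTrailingDegree := rootMultiplicity_eq_natTrailingDegree'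
  have hroots := Literature.Algebra.Polynomial.Descartes.roots_reverse_of_ne_zero hf
  have hcard : f.reverse.roots.card + f.rootMultiplicity 0 = f.roots.card := by
    rw [hroots, Multiset.card_map, ← count_roots, Multiset.count_eq_card_filter_eq]
    have h := congrArg Multiset.card (Multiset.filter_add_not (fun x : ℝ => x ≠ 0) f.roots)
    rw [Multiset.card_add] at h
    have h2 : (Multiset.filter (fun a : ℝ => ¬a ≠ 0) f.roots) = Multiset.filter (fun x : ℝ => (0 : ℝ) = x) f.roots :=
      Multiset.filter_congr fun x _ => by simp [eq_comm]
    rw [h2] at h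
    exact h
  have h3 := card_roots' f.reverse
  omega


/-- `reflect D f = X^(D − deg f) · reverse f` when `deg f ≤ D`. -/
theorem reflect_eq_X_pow_mul_reverse {f : ℝ[X]} {D : ℕ} (hD : f.natDegree ≤ D) :
    reflect D f = X ^ (D - f.natDegree) * f.reverse := by
  ext j
  rw [coeff_reflect, coeff_X_pow_mul', coeff_reverse]
  by_cases hj : j ≤ D
  · rw [revAt_le hj]
    split_ifs with h
    · rw [revAt_le (by omega)]
      congr 1
      omega
    · exact coeff_eq_zero_of_natDegree_lt (by omega)
  · rw [revAt_eq_self_of_lt (by omega), if_pos (by omega), revAt_eq_self_of_lt (by omega)]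
    rw [coeff_eq_zero_of_natDegree_lt (by omega), coeff_eq_zero_of_natDegree_lt (by omega)]

/-- `N(reflect D f) = N(f)` when `deg f ≤ D`. -/
theorem nonrealRootCount_reflect {f : ℝ[X]} {D : ℕ} (hD : f.natDegree ≤ D) :
    nonrealRootCount (reflect D f) = nonrealRootCount f := by
  rcases eq_or_ne f 0 with rfl | hf
  · simp [nonrealRootCount]
  rw [reflect_eq_X_pow_mul_reverse hD, nonrealRootCount_X_pow_mul _ (by rwa [Ne, reverse_eq_zero]),
    nonrealRootCount_reverse]

/-- The key identity: reflection at `D ≥ deg q` conjugates `q ↦ D·q − X·q'` into `p ↦ X·p'`. -/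
theorem reflect_euler {q : ℝ[X]} {D : ℕ} (hD : q.natDegree ≤ D) :
    reflect D (C (D : ℝ) * q - X * derivative q) = X * derivative (reflect D q) := by
  ext j
  rw [coeff_reflect, coeff_sub, coeff_C_mul]
  have hXd : ∀ r : ℕ, (X * derivative q).coeff r = (r : ℝ) * q.coeff r := by
    intro r
    rcases r with _ | r
    · simp
    · rw [coeff_X_mul, coeff_derivative]; push_cast; ring
  have hXd' : ∀ r : ℕ, (X * derivative (reflect D q)).coeff r = (r : ℝ) * (reflect D q).coeff r := by
    intro r
    rcases r with _ | r
    · simp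
    · rw [coeff_X_mul, coeff_derivative]; push_cast; ring
  rw [hXd, hXd', coeff_reflect]
  by_cases hj : j ≤ D
  · rw [revAt_le hj]
    push_cast [Nat.cast_sub hj]
    ring
  · rw [revAt_eq_self_of_lt (by omega), coeff_eq_zero_of_natDegree_lt (by omega : q.natDegree < j)]
    ring

/-- The Euler-type descent operator `q ↦ D·q − X·q'` does not increase `N` on `deg q ≤ D` (`D ≥ 1`):
reflect at `D`, Rolle, reflect back. -/
theorem nonrealRootCount_euler_le (D : ℕ) (q : ℝ[X]) (hD1 : 1 ≤ D) (hq : q.natDegree ≤ D) :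
    nonrealRootCount (C (D : ℝ) * q - X * derivative q) ≤ nonrealRootCount q := by
  have hT : (C (D : ℝ) * q - X * derivative q).natDegree ≤ D := by
    refine (natDegree_sub_le _ _).trans (max_le ((natDegree_C_mul_le _ _).trans hq) ?_)
    refine (natDegree_mul_le).trans ?_
    have := natDegree_derivative_le q
    simp only [natDegree_X]
    omega
  rw [← nonrealRootCount_reflect hT, reflect_euler hq, ← nonrealRootCount_reflect hq]
  rcases eq_or_ne (derivative (reflect D q)) 0 with h0 | h0
  · rw [h0, mul_zero]; simp [nonrealRootCount]
  · rw [← pow_one (X : ℝ[X]), nonrealRootCount_X_pow_mul 1 h0]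
    exact nonrealRootCount_derivative_le _

/-- **T1 (proved, unconditional): the number of non-real zeros of `J^{d,n}_γ` is non-decreasing in `d`, for every real
sequence `γ`.** -/
theorem nonrealRootCount_jensenPoly_succ_le (γ : ℕ → ℝ) (d n : ℕ) :
    nonrealRootCount (jensenPoly γ d n) ≤ nonrealRootCount (jensenPoly γ (d + 1) n) := by
  have hne : ((d : ℝ) + 1) ≠ 0 := by positivity
  rw [← nonrealRootCount_C_mul hne (jensenPoly γ d n), descent_identity γ d n]
  have hdeg : (jensenPoly γ (d + 1) n).natDegree ≤ d + 1 := by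
    unfold jensenPoly
    refine (natDegree_sum_le_of_forall_le _ _ fun k hk => ?_)
    exact (natDegree_C_mul_X_pow_le _ _).trans (Nat.le_of_lt_succ (Finset.mem_range.1 hk))
  have := nonrealRootCount_euler_le (d + 1) (jensenPoly γ (d + 1) n) (by omega) hdeg
  simpa using this

/-- Monotonicity in the degree: `N(J^{d,n}) ≤ N(J^{d',n})` for `d ≤ d'` (iterate of the one-step bound). -/
theorem nonrealRootCount_jensenPoly_mono (γ : ℕ → ℝ) {d d' : ℕ} (n : ℕ) (hdd : d ≤ d') :
    nonrealRootCount (jensenPoly γ d n) ≤ nonrealRootCount (jensenPoly γ d' n) := by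
  obtain ⟨j, rfl⟩ := Nat.exists_eq_add_of_le hdd
  induction j with
  | zero => simp
  | succ j ih =>
    exact (ih (by omega)).trans (by simpa [Nat.add_assoc] using nonrealRootCount_jensenPoly_succ_le γ (d + j) n)

/-- **Births are thresholds (proved, unconditional):** if `J^{d,n}_γ` is not hyperbolic then no `J^{d',n}_γ` with
`d' ≥ d` is — the converse companion of the tree's degree descent `JensenDegreeDescent.splits_jensenPoly_of_le`. -/
theorem not_splits_jensenPoly_of_le (γ : ℕ → ℝ) {d d' n : ℕ} (hdd : d ≤ d')
    (h : ¬ (jensenPoly γ d n).Splits) : ¬ (jensenPoly γ d' n).Splits := by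
  rw [← nonrealRootCount_eq_zero_iff] at h ⊢
  have := nonrealRootCount_jensenPoly_mono γ n hdd
  omega

/-- Hence (proved): for each row the set of hyperbolic degrees is an initial segment `{d | d < δ}` or all of `ℕ`. -/
theorem splits_iff_lt_birth (γ : ℕ → ℝ) (n : ℕ) :
    (∀ d, (jensenPoly γ d n).Splits) ∨ ∃ δ : ℕ, ∀ d, (jensenPoly γ d n).Splits ↔ d < δ := by
  classical
  by_cases h : ∀ d, (jensenPoly γ d n).Splits
  · exact Or.inl h
  · right
    push Not at h
    refine ⟨Nat.find h, fun d => ⟨fun hs => ?_, fun hd => ?_⟩⟩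
    · by_contra hlt
      exact not_splits_jensenPoly_of_le γ (not_lt.mp hlt) (Nat.find_spec h) hs
    · by_contra hs
      exact Nat.find_min h hd hs

end Summit.RiemannHypothesis.RiemannHypothesis.Theorems.Splittings.JensenCountMonotonicity

end
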